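import Summits.QuantumFields.BalabanUV.Beta.FP.TowerDoorPeriodisedSource
import Summits.QuantumFields.BalabanUV.Beta.FP.TowerDoorPeriodisedLinear
import Summits.QuantumFields.BalabanUV.Beta.FP.TowerDoorDefectCovariance
import Summits.QuantumFields.BalabanUV.Beta.FP.KernelPeriodisationFibTrace

/-!
# `BalabanUV.Beta.FP.TowerDoorPeriodisedWindow` — binder row D1, the row's ONE file, (T2) `hWΔT` part (D-b2) (J-NOTE-21 §5; v10 `FP/StepRecursionFeedNestedNamedI` l.217):
# **THE SOURCE-WOUND TORUS TABLE OF THE DOOR, GENERIC LETTERS** — `perF T ∘ dper T` passes through the door's window superposition and the lattice window sum regroups into the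
# coarse box and its translates, the translates becoming SOURCE copies:
# `perZ T (dper T (x w ↦ Σ'_e doorZ … μ y ν (translate Mc y′ e) x w)) x w a b`
# `  = κΔ · Σ_κ Σ_{ȳ₀ ∈ pbox Mc} ((Σ'_e S ν (translate Mc y′ e) κ ȳ₀) · perZ T (dper T (defKerZ … Λ_(μ,y) (ȳ₀,κ))) x w a b + (Σ'_e S μ (translate Mc y e) κ ȳ₀) · perZ T (dper T (defKerZ … Λ_(ν,y′) (ȳ₀,κ))) x w a b)`
# with the PERIODISED GAUGE FUNCTIONS `Λ_(μ,y) u := Σ'_e lam μ (translate Mc y e) u` — (T2) up to the three record identifications (PART 47 weight, the road's second socket, PART 57 gauge)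
# (β-function cell `pub-balaban`, BINDER-OWNERS row D1 ∕ (C1) OWNER «beta-an2» gen 78, PART 72; imports PART 70 + PART 71 + PART 68 + road `KernelPeriodisationFibTrace`)

WHY (located; J-NOTE-21 §5 steps (1)–(4), journal [AN2-G78-ONLINE] A-1 (i)).  After PART 71 the wound door is, as a kernel, `κΔ·Σ_κ Σ'_{y₀} (Ŝ′(y₀)·D₁(y₀) + S μ y κ y₀·D₂(y₀))` with
`D₁(y₀) = defKerZ … (lam μ y) (y₀,κ)` (bi-localised at `(L•y₀, L•y₀)`, constant `A·e^{−(ρ/2)|L•y − L•y₀|₁}` — PART 71 §1 over road (R1)) and `D₂(y₀) = defKerZ … Λ_(ν,y′) (y₀,κ)` (bi-localised, constant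
uniform — PART 64, `Λ` bounded by PART 71 §2); the constants are summable in `y₀`, so PART 70 `perZ_dper_tsum_of_biLoc` takes `perZ T ∘ dper T` inside (§3).  The window sum over `ℤ⁴` is
`Σ_{ȳ₀ ∈ pbox Mc} Σ'_{m₁}` (road `tsum_sites_eq_sum_tsum`); on the second term the window translate is a diagonal `T`-shift of `D₂` (`Λ` is `T`-periodic; PART 68 `defKerZ_translate`), invisible
to `dper T` (PART 70 `dper_shiftK_period`), and the weight copies re-sum into `Σ'_e S μ (translate Mc y e) κ ȳ₀` by the weight's covariance; on the first term the window translate becomes a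
SOURCE translate of the gauge function (`hlamt`, PART 58's shape, + PART 68), the weight is `Mc`-periodic in the window, and the source copies re-enter the gauge slot by PART 70 §4 backwards and
road (R3) `defKerZ_tsum` (§2, §4).

WHAT ([folklore] `tsum` bookkeeping BY NAME; (Lmix)(LH) READ OFF `tabs`; hypotheses = v10's record shapes: `hlam` (PART 59), `hlamt` (PART 58 `lamZ_translate`), `hS` (lit `decay_wΦ`), `hSt` (`wΦ κ ν (y₀ − z)`),
`hT : T i = L·Mc i`; no `def`, no `def … : Prop`, nothing cited, 0 sorry).
* §1 `biLoc_lin2` (two scalar-weighted bi-localised kernels at one centre and rate), `neg_smul_period_eq` (`−(L • Mc∘m) = T∘(−m)`).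
* §2 covariance ∕ re-indexing: `tsum_weight_translate_window` (`Ŝ′` is `Mc`-periodic in the window), `tsum_weight_window_eq_sources` (`Σ'_m S μ y κ (translate Mc ȳ₀ m) = Σ'_e S μ (translate Mc y e) κ ȳ₀`),
  `lam_apply_eq_translate_neg`, `tsum_lam_sources_sub_period` ∕ `tsum_lam_sources_translate_period` (`Λ` is `T`-periodic — the road's second socket's `hΛ`),
  `perZ_dper_defKerZ_window_translate_lam` (window translate ↦ source translate under `perZ T ∘ dper T`),
  `perZ_dper_defKerZ_window_translate_periodic` (window translate invisible for a `T`-periodic gauge function).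
* §3 **`perZ_dper_window_tsum`** (PART 70 §4 through ONE direction's window superposition, with the `y₀`-summabilities of the result).  The regrouping into the coarse box and the
  assembled display above are PART 73 `FP/TowerDoorPeriodisedRegroup` (split for the 400-line rule).
WHAT THIS IS NOT: not (T2) at the record (part (D-c): `𝒲Δ := doorRec …`, PART 47 for the weight, the road's second socket for `perF T (dper T (defKerZ … Λ β̄))|ff`, PART 57 for `Λ ↔ lv`, the scalar
pin `κτ·cS = −(sn·cM₂·r)·(sn·r)`); nothing of Bałaban's asserted, valued or discharged; 0 estimates beyond existential bookkeeping constants; 0∕4 row-D1 binders (hW, hR, D1Tel, D1Rep); v10 NOT filed;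
v9 p617999 stands; NOT (C1), NOT (T-ID), NOT D1, NEVER «G-an2-4 closed», NOT BetaPertH, NOT continuum, NOT Clay.

HONEST DEPENDENCY (page 1, mandatory): continuum YM on T⁴ ⇐ BetaPertH ∧ nine spine estimates (0/9 proved); BetaPertH ⇐ (D1) ∧ (D4) ∧ CAP+tail;
G-an2-4 gates asym, D1 and NE2/3/4.  HONEST FRAMING (cell contract, verbatim): «discharging `BetaPertH` makes Bałaban's UV stability UNCONDITIONAL —
a real constructive-QFT result; it is NOT the continuum limit and NOT the Clay problem.»  ABSOLUTE RULE (cell charter, verbatim): «No internally-minted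
statement may enter as a cited fact. Every hypothesis is either kernel-proved in this package or a verbatim quotation of a PUBLISHED theorem with page
reference. The manuscript(s) under audit are NOT citable for their own disputed steps — they are the thing under adjudication; programme-internal
(2001/route/tribunal) claims are never citable.»  Row D1 ∕ (C1) OWNER «beta-an2» gen 78, 2026-08-29.  No existing file touched.
-/

noncomputable section

open Finset
open scoped BigOperators
open Literature.MathematicalPhysics.QuantumFieldTheory
open Literature.MathematicalPhysics.QuantumFieldTheory.Balaban1983to89
open Literature.MathematicalPhysics.QuantumFieldTheory.Balaban1983to89.Beta
open Literature.MathematicalPhysics.QuantumFieldTheory.Balaban1983to89.B12Sec2to5 (l1 l1_nonneg)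
open B4TorusKernel.MultiPeriod (translate translate_apply translate_injective)
open B4Reflection242 (translate_translate)
open B4Sect5Proof (latticeConst latticeConst_nonneg)
open B6Lemma24Torus (pbox)
open AffineAveraging (Site unitVec)
open OneStepResolventKernel (Fib biLoc_mono)
open ExpKernelCalculus (MKer BiLoc shiftK l1_sub_symm summable_exp_shift summable_exp_shift')
open Summit.QuantumFields.BalabanUV.Beta.SymmetrisedStepJets (SymTables)
open Summit.QuantumFields.BalabanUV.Beta.FP.KernelPeriodisationFib (perZ translate_eq_add)
open Summit.QuantumFields.BalabanUV.Beta.FP.KernelPeriodisationFibLoc (dper summable_exp_l1_translate)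
open Summit.QuantumFields.BalabanUV.Beta.FP.KernelPeriodisationFibTrace (tsum_sites_eq_sum_tsum)
open Summit.QuantumFields.BalabanUV.Beta.FP.TowerK2bDoorReadoutPeriodised (translate_smul_eq_smul_translate)
open Summit.QuantumFields.BalabanUV.Beta.FP.TowerDoorDefectDefs
open Summit.QuantumFields.BalabanUV.Beta.FP.TowerDoorDefectCovariance (defKerZ_translate)
open Summit.QuantumFields.BalabanUV.Beta.FP.TowerDoorDefectLinear (defKerZ_tsum)
open Summit.QuantumFields.BalabanUV.Beta.FP.TowerDoorPeriodisedLinear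
open Summit.QuantumFields.BalabanUV.Beta.FP.TowerDoorPeriodisedSource

namespace Summit.QuantumFields.BalabanUV.Beta.FP.TowerDoorPeriodisedWindow

variable (L : ℕ) (tabs : SymTables 3 L) (κ₂ : ℝ)

/-! ## §1 Two small tools -/

/-- [folklore] **`biLoc_lin2`**: two scalar-weighted kernels bi-localised at one centre and rate combine (`|c₁|C₁ + |c₂|C₂`). -/
theorem biLoc_lin2 {K₁ K₂ : MKer (3 + 1) (Fib 3)} {p : Site (3 + 1)} {C₁ C₂ δ : ℝ} (h₁ : BiLoc K₁ p p C₁ δ) (h₂ : BiLoc K₂ p p C₂ δ) (c₁ c₂ : ℝ) :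
    BiLoc (fun x w a b => c₁ * K₁ x w a b + c₂ * K₂ x w a b) p p (|c₁| * C₁ + |c₂| * C₂) δ := by
  intro x w a b
  calc |c₁ * K₁ x w a b + c₂ * K₂ x w a b| ≤ |c₁| * |K₁ x w a b| + |c₂| * |K₂ x w a b| := by
        refine (abs_add_le _ _).trans ?_; rw [abs_mul, abs_mul]
    _ ≤ |c₁| * (C₁ * Real.exp (-δ * (l1 (x - p) + l1 (w - p)))) + |c₂| * (C₂ * Real.exp (-δ * (l1 (x - p) + l1 (w - p)))) :=
        add_le_add (mul_le_mul_of_nonneg_left (h₁ x w a b) (abs_nonneg _)) (mul_le_mul_of_nonneg_left (h₂ x w a b) (abs_nonneg _))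
    _ = (|c₁| * C₁ + |c₂| * C₂) * Real.exp (-δ * (l1 (x - p) + l1 (w - p))) := by ring

/-- [folklore] **`neg_smul_period_eq`**: `−(L • Mc∘m) = T∘(−m)` for `T i = L · Mc i` (the window period vector, in blocks, is a torus period vector). -/
theorem neg_smul_period_eq (Mc T : Fin (3 + 1) → ℕ) (hT : ∀ i, T i = L * Mc i) (m : Site (3 + 1)) :
    -(((L : ℕ) : ℤ) • (fun i => (Mc i : ℤ) * m i : Site (3 + 1))) = fun i => (T i : ℤ) * (-m) i := by
  funext i
  simp only [Pi.neg_apply, Pi.smul_apply, smul_eq_mul, hT i, Nat.cast_mul]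
  ring

/-! ## §2 Covariance and re-indexing of the weight and of the gauge function -/

section Covariance

variable {L}
variable (lam : Fin (3 + 1) → Site (3 + 1) → (Site (3 + 1) → ℝ)) (S : Fin (3 + 1) → Site (3 + 1) → Fin (3 + 1) → Site (3 + 1) → ℝ)
variable (Mc : Fin (3 + 1) → ℕ)

/-- [folklore] **`tsum_weight_translate_window`** — the wound weight is `Mc`-PERIODIC IN THE WINDOW: `Σ'_e S ν (translate Mc y′ e) κ (translate Mc y₀ m) = Σ'_e S ν (translate Mc y′ e) κ y₀`
(covariance `hSt`, re-indexing `e ↦ e − m`; no convergence needed). -/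
theorem tsum_weight_translate_window (hSt : ∀ ν z κ y₀ t, S ν (z + t) κ (y₀ + t) = S ν z κ y₀)
    (ν : Fin (3 + 1)) (y' : Site (3 + 1)) (κ : Fin (3 + 1)) (y₀ m : Site (3 + 1)) :
    ∑' e : Site (3 + 1), S ν (translate Mc y' e) κ (translate Mc y₀ m) = ∑' e : Site (3 + 1), S ν (translate Mc y' e) κ y₀ := by
  have h : ∀ e : Site (3 + 1), S ν (translate Mc y' e) κ (translate Mc y₀ m) = S ν (translate Mc y' (e - m)) κ y₀ := by
    intro e
    have e1 : translate Mc y' e = translate Mc y' (e - m) + (fun i => (Mc i : ℤ) * m i : Site (3 + 1)) := by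
      rw [← translate_eq_add, translate_translate, sub_add_cancel]
    rw [e1, translate_eq_add Mc y₀ m, hSt]
  simp_rw [h]
  exact (Equiv.subRight m).tsum_eq (fun e : Site (3 + 1) => S ν (translate Mc y' e) κ y₀)

/-- [folklore] **`tsum_weight_window_eq_sources`** — THE WEIGHT's WINDOW COPIES ARE ITS SOURCE COPIES: `Σ'_m S μ y κ (translate Mc y₀ m) = Σ'_e S μ (translate Mc y e) κ y₀`
(covariance, re-indexing `m ↦ −m`). -/
theorem tsum_weight_window_eq_sources (hSt : ∀ ν z κ y₀ t, S ν (z + t) κ (y₀ + t) = S ν z κ y₀)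
    (μ : Fin (3 + 1)) (y : Site (3 + 1)) (κ : Fin (3 + 1)) (y₀ : Site (3 + 1)) :
    ∑' m : Site (3 + 1), S μ y κ (translate Mc y₀ m) = ∑' e : Site (3 + 1), S μ (translate Mc y e) κ y₀ := by
  have h : ∀ m : Site (3 + 1), S μ y κ (translate Mc y₀ m) = S μ (translate Mc y (-m)) κ y₀ := by
    intro m
    have e1 : y = translate Mc y (-m) + (fun i => (Mc i : ℤ) * m i : Site (3 + 1)) := by
      rw [translate_eq_add]; funext i; simp only [Pi.add_apply, Pi.neg_apply]; ring
    conv_lhs => rw [e1, translate_eq_add Mc y₀ m]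
    rw [hSt]
  simp_rw [h]
  exact (Equiv.neg (Site (3 + 1))).tsum_eq (fun e : Site (3 + 1) => S μ (translate Mc y e) κ y₀)

/-- [folklore] **`lam_apply_eq_translate_neg`** — a gauge function is the `L`-block translate of the gauge function of the translated source (`hlamt`, PART 58's shape):
`lam μ y u = lam μ (translate Mc y (−m)) (u − L • Mc∘m)`. -/
theorem lam_apply_eq_translate_neg (hlamt : ∀ μ y u t, lam μ (y + t) (u + ((L : ℕ) : ℤ) • t) = lam μ y u)
    (μ : Fin (3 + 1)) (y u m : Site (3 + 1)) :
    lam μ y u = lam μ (translate Mc y (-m)) (u - ((L : ℕ) : ℤ) • (fun i => (Mc i : ℤ) * m i : Site (3 + 1))) := by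
  have h := hlamt μ (translate Mc y (-m)) (u - ((L : ℕ) : ℤ) • (fun i => (Mc i : ℤ) * m i : Site (3 + 1))) (fun i => (Mc i : ℤ) * m i)
  rw [sub_add_cancel] at h
  have e1 : translate Mc y (-m) + (fun i => (Mc i : ℤ) * m i : Site (3 + 1)) = y := by
    rw [translate_eq_add]; funext i; simp only [Pi.add_apply, Pi.neg_apply]; ring
  rw [e1] at h
  exact h

/-- [folklore] **`tsum_lam_sources_sub_period`** — THE PERIODISED GAUGE FUNCTION IS `T`-PERIODIC: `Σ'_e lam μ (translate Mc y e) (u − L • Mc∘m) = Σ'_e lam μ (translate Mc y e) u`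
(`hlamt` with `t := −Mc∘m` turns the block shift into the source re-indexing `e ↦ e + m`). -/
theorem tsum_lam_sources_sub_period (hlamt : ∀ μ y u t, lam μ (y + t) (u + ((L : ℕ) : ℤ) • t) = lam μ y u)
    (μ : Fin (3 + 1)) (y u m : Site (3 + 1)) :
    ∑' e : Site (3 + 1), lam μ (translate Mc y e) (u - ((L : ℕ) : ℤ) • (fun i => (Mc i : ℤ) * m i : Site (3 + 1)))
      = ∑' e : Site (3 + 1), lam μ (translate Mc y e) u := by
  have h : ∀ e : Site (3 + 1), lam μ (translate Mc y e) (u - ((L : ℕ) : ℤ) • (fun i => (Mc i : ℤ) * m i : Site (3 + 1))) = lam μ (translate Mc y (e + m)) u := by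
    intro e
    have h1 := hlamt μ (translate Mc y (e + m)) u (fun i => -((Mc i : ℤ) * m i))
    have e1 : translate Mc y (e + m) + (fun i => -((Mc i : ℤ) * m i) : Site (3 + 1)) = translate Mc y e := by
      funext i; simp only [Pi.add_apply, translate_apply]; ring
    have e2 : u + ((L : ℕ) : ℤ) • (fun i => -((Mc i : ℤ) * m i) : Site (3 + 1)) = u - ((L : ℕ) : ℤ) • (fun i => (Mc i : ℤ) * m i : Site (3 + 1)) := by
      funext i; simp only [Pi.add_apply, Pi.sub_apply, Pi.smul_apply, smul_eq_mul]; ring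
    rw [e1, e2] at h1
    exact h1
  simp_rw [h]
  exact (Equiv.addRight m).tsum_eq (fun e : Site (3 + 1) => lam μ (translate Mc y e) u)

variable (T : Fin (3 + 1) → ℕ) (hT : ∀ i, T i = L * Mc i)

include hT in
/-- [folklore] **`tsum_lam_sources_translate_period`** — the same in the torus letter: `Σ'_e lam μ (translate Mc y e) (translate T u m) = Σ'_e lam μ (translate Mc y e) u`
(the road's second socket's `hΛ` hypothesis for `Λ_(μ,y)`; `translate T u m = u − L • Mc∘(−m)` by `hT`). -/
theorem tsum_lam_sources_translate_period (hlamt : ∀ μ y u t, lam μ (y + t) (u + ((L : ℕ) : ℤ) • t) = lam μ y u)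
    (μ : Fin (3 + 1)) (y u m : Site (3 + 1)) :
    ∑' e : Site (3 + 1), lam μ (translate Mc y e) (translate T u m) = ∑' e : Site (3 + 1), lam μ (translate Mc y e) u := by
  have e1 : translate T u m = u - ((L : ℕ) : ℤ) • (fun i => (Mc i : ℤ) * (-m) i : Site (3 + 1)) := by
    funext i
    simp only [translate_apply, Pi.sub_apply, Pi.smul_apply, Pi.neg_apply, smul_eq_mul, hT i, Nat.cast_mul]
    ring
  rw [e1]
  exact tsum_lam_sources_sub_period lam Mc hlamt μ y u (-m)

include hT in
/-- [folklore] **`perZ_dper_defKerZ_window_translate_lam` — A WINDOW TRANSLATE IS A SOURCE TRANSLATE UNDER `perZ T ∘ dper T`**: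
`perZ T (dper T (defKerZ … (lam μ y) (translate Mc y₀ m, κ))) = perZ T (dper T (defKerZ … (lam μ (translate Mc y (−m))) (y₀, κ)))`
(§2 `lam_apply_eq_translate_neg`, PART 68 `defKerZ_translate`, PART 70 `dper_shiftK_period` at `−m`). -/
theorem perZ_dper_defKerZ_window_translate_lam (hlamt : ∀ μ y u t, lam μ (y + t) (u + ((L : ℕ) : ℤ) • t) = lam μ y u)
    (μ : Fin (3 + 1)) (y : Site (3 + 1)) (κ : Fin (3 + 1)) (y₀ m : Site (3 + 1)) :
    perZ T (dper T (defKerZ L tabs κ₂ (lam μ y) (translate Mc y₀ m, κ)))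
      = perZ T (dper T (defKerZ L tabs κ₂ (lam μ (translate Mc y (-m))) (y₀, κ))) := by
  have hv : lam μ y = fun u => lam μ (translate Mc y (-m)) (u - ((L : ℕ) : ℤ) • (fun i => (Mc i : ℤ) * m i : Site (3 + 1))) :=
    funext fun u => lam_apply_eq_translate_neg lam Mc hlamt μ y u m
  rw [hv, translate_eq_add Mc y₀ m]
  rw [show ((y₀ + fun i => (Mc i : ℤ) * m i, κ) : Site (3 + 1) × Fin (3 + 1))
      = (((y₀, κ) : Site (3 + 1) × Fin (3 + 1)).1 + (fun i => (Mc i : ℤ) * m i), ((y₀, κ) : Site (3 + 1) × Fin (3 + 1)).2) from rfl,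
    defKerZ_translate L tabs κ₂ (lam μ (translate Mc y (-m))) (fun i => (Mc i : ℤ) * m i) (y₀, κ),
    neg_smul_period_eq L Mc T hT m, dper_shiftK_period]

include hT in
/-- [folklore] **`perZ_dper_defKerZ_window_translate_periodic` — A WINDOW TRANSLATE IS INVISIBLE FOR A `T`-PERIODIC GAUGE FUNCTION**: if `v (u − L • Mc∘m) = v u` for all `u m`, then
`perZ T (dper T (defKerZ … v (translate Mc y₀ m, κ))) = perZ T (dper T (defKerZ … v (y₀, κ)))`. -/
theorem perZ_dper_defKerZ_window_translate_periodic {v : Site (3 + 1) → ℝ}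
    (hv : ∀ u m : Site (3 + 1), v (u - ((L : ℕ) : ℤ) • (fun i => (Mc i : ℤ) * m i : Site (3 + 1))) = v u)
    (κ : Fin (3 + 1)) (y₀ m : Site (3 + 1)) :
    perZ T (dper T (defKerZ L tabs κ₂ v (translate Mc y₀ m, κ))) = perZ T (dper T (defKerZ L tabs κ₂ v (y₀, κ))) := by
  have hv' : (fun u => v (u - ((L : ℕ) : ℤ) • (fun i => (Mc i : ℤ) * m i : Site (3 + 1)))) = v := funext fun u => hv u m
  conv_lhs => rw [← hv', translate_eq_add Mc y₀ m]
  rw [show ((y₀ + fun i => (Mc i : ℤ) * m i, κ) : Site (3 + 1) × Fin (3 + 1))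
      = (((y₀, κ) : Site (3 + 1) × Fin (3 + 1)).1 + (fun i => (Mc i : ℤ) * m i), ((y₀, κ) : Site (3 + 1) × Fin (3 + 1)).2) from rfl,
    defKerZ_translate L tabs κ₂ v (fun i => (Mc i : ℤ) * m i) (y₀, κ), neg_smul_period_eq L Mc T hT m, dper_shiftK_period]

end Covariance

/-! ## §3 `perZ T ∘ dper T` through one direction's window superposition -/

section Window

variable {L}
variable (lam : Fin (3 + 1) → Site (3 + 1) → (Site (3 + 1) → ℝ)) (S : Fin (3 + 1) → Site (3 + 1) → Fin (3 + 1) → Site (3 + 1) → ℝ)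
variable {K δv CS δS : ℝ}
set_option maxHeartbeats 400000 in
/-- [folklore] **`perZ_dper_window_tsum`** — ONE DIRECTION's WINDOW SUPERPOSITION: for the weights `Ŝ′(y₀) := Σ'_e S ν (translate Mc y′ e) κ y₀` (bounded) and `S μ y κ y₀` (exponentially small) and the
kernels `D₁(y₀) := defKerZ … (lam μ y) (y₀,κ)`, `D₂(y₀) := defKerZ … Λ (y₀,κ)` (`Λ` the periodised gauge function of `(ν,y′)`), the family `y₀ ↦ Ŝ′(y₀)·D₁(y₀) + S μ y κ y₀·D₂(y₀)` is bi-localised at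
`(L•y₀, L•y₀)` with summable constants, so (PART 70 §4)
`perZ T (dper T (x w ↦ Σ'_{y₀} (Ŝ′(y₀)·D₁(y₀) x w + S μ y κ y₀·D₂(y₀) x w))) x w a b = Σ'_{y₀} (Ŝ′(y₀)·perZ T (dper T D₁(y₀)) x w a b + S μ y κ y₀·perZ T (dper T D₂(y₀)) x w a b)`,
together with the `(t,j)`-summability of the superposed kernel and the `y₀`-summability of the two resulting families. -/
theorem perZ_dper_window_tsum [NeZero L] (Mc T : Fin (3 + 1) → ℕ) [∀ i, NeZero (Mc i)] [∀ i, NeZero (T i)] (hT : ∀ i, T i = L * Mc i)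
    (hK : 0 ≤ K) (hδv : 0 < δv) (hlam : ∀ μ y u, |lam μ y u| ≤ K * Real.exp (-δv * l1 (((L : ℕ) : ℤ) • y - u)))
    (hCS : 0 ≤ CS) (hδS : 0 < δS) (hS : ∀ ν z κ y₀, |S ν z κ y₀| ≤ CS * Real.exp (-δS * l1 (y₀ - z)))
    (μ : Fin (3 + 1)) (y : Site (3 + 1)) (ν : Fin (3 + 1)) (y' : Site (3 + 1)) (κ : Fin (3 + 1)) (x w : Site (3 + 1)) (a b : Fib 3) :
    (perZ T (dper T (fun x' w' a' b' => ∑' y₀ : Site (3 + 1),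
        ((∑' e : Site (3 + 1), S ν (translate Mc y' e) κ y₀) * defKerZ L tabs κ₂ (lam μ y) (y₀, κ) x' w' a' b'
          + S μ y κ y₀ * defKerZ L tabs κ₂ (fun u => ∑' e : Site (3 + 1), lam ν (translate Mc y' e) u) (y₀, κ) x' w' a' b'))) x w a b
      = ∑' y₀ : Site (3 + 1),
        ((∑' e : Site (3 + 1), S ν (translate Mc y' e) κ y₀) * perZ T (dper T (defKerZ L tabs κ₂ (lam μ y) (y₀, κ))) x w a b
          + S μ y κ y₀ * perZ T (dper T (defKerZ L tabs κ₂ (fun u => ∑' e : Site (3 + 1), lam ν (translate Mc y' e) u) (y₀, κ))) x w a b)) ∧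
    Summable (fun c : Site (3 + 1) × Site (3 + 1) => ∑' y₀ : Site (3 + 1),
        ((∑' e : Site (3 + 1), S ν (translate Mc y' e) κ y₀) * defKerZ L tabs κ₂ (lam μ y) (y₀, κ) (translate T x c.2) (translate T (translate T w c.1) c.2) a b
          + S μ y κ y₀ * defKerZ L tabs κ₂ (fun u => ∑' e : Site (3 + 1), lam ν (translate Mc y' e) u) (y₀, κ)
              (translate T x c.2) (translate T (translate T w c.1) c.2) a b)) ∧
    Summable (fun y₀ : Site (3 + 1) =>
        (∑' e : Site (3 + 1), S ν (translate Mc y' e) κ y₀) * perZ T (dper T (defKerZ L tabs κ₂ (lam μ y) (y₀, κ))) x w a b) ∧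
    Summable (fun y₀ : Site (3 + 1) =>
        S μ y κ y₀ * perZ T (dper T (defKerZ L tabs κ₂ (fun u => ∑' e : Site (3 + 1), lam ν (translate Mc y' e) u) (y₀, κ))) x w a b) := by
  have hL : 1 ≤ L := Nat.one_le_iff_ne_zero.mpr (NeZero.ne L)
  -- the two bi-localisations, one rate
  obtain ⟨ρ₁, A₁, hρ₁, hA₁, hD₁⟩ := exists_biLoc_defKerZ_lam L tabs κ₂ hK hδv hlam
  have hV : 0 ≤ K * latticeConst (3 + 1) δv := mul_nonneg hK (latticeConst_nonneg (3 + 1) hδv.le)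
  obtain ⟨ρ₂, A₂, hρ₂, hA₂, hD₂⟩ := exists_biLoc_defKerZ_bdd L tabs κ₂ hV
  have hδ0 : 0 < min (ρ₁ / 4) ρ₂ := lt_min (by positivity) hρ₂
  have hΛ : ∀ u : Site (3 + 1), |∑' e : Site (3 + 1), lam ν (translate Mc y' e) u| ≤ K * latticeConst (3 + 1) δv :=
    fun u => abs_tsum_lam_sources_le Mc T hT hK hδv hlam ν y' u
  -- the weights
  have hSw : ∀ y₀ : Site (3 + 1), |∑' e : Site (3 + 1), S ν (translate Mc y' e) κ y₀| ≤ CS * latticeConst (3 + 1) δS := by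
    intro y₀
    obtain ⟨hs, hle⟩ := summable_exp_l1_translate Mc hδS y₀ y'
    have hb : ∀ e : Site (3 + 1), |S ν (translate Mc y' e) κ y₀| ≤ CS * Real.exp (-δS * l1 (translate Mc y' e - y₀)) := fun e => by
      rw [l1_sub_symm]; exact hS ν _ κ y₀
    have h := norm_tsum_le_tsum_norm (f := fun e : Site (3 + 1) => S ν (translate Mc y' e) κ y₀)
      (by simpa only [Real.norm_eq_abs] using (hs.mul_left CS).of_nonneg_of_le (fun e => abs_nonneg _) hb)
    simp only [Real.norm_eq_abs] at h
    refine h.trans ((((hs.mul_left CS).of_nonneg_of_le (fun e => abs_nonneg _) hb).tsum_le_tsum hb (hs.mul_left CS)).trans ?_)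
    rw [tsum_mul_left]; exact mul_le_mul_of_nonneg_left hle hCS
  -- the family and its constants
  have hfam : ∀ y₀ : Site (3 + 1), BiLoc (fun x' w' a' b' =>
      (∑' e : Site (3 + 1), S ν (translate Mc y' e) κ y₀) * defKerZ L tabs κ₂ (lam μ y) (y₀, κ) x' w' a' b'
        + S μ y κ y₀ * defKerZ L tabs κ₂ (fun u => ∑' e : Site (3 + 1), lam ν (translate Mc y' e) u) (y₀, κ) x' w' a' b')
      (((L : ℕ) : ℤ) • y₀) (((L : ℕ) : ℤ) • y₀)
      (|∑' e : Site (3 + 1), S ν (translate Mc y' e) κ y₀| * (A₁ * Real.exp (-(ρ₁ / 2) * l1 (((L : ℕ) : ℤ) • y - ((L : ℕ) : ℤ) • y₀)))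
        + |S μ y κ y₀| * A₂) (min (ρ₁ / 4) ρ₂) := by
    intro y₀
    exact biLoc_lin2 (biLoc_mono (hD₁ μ y (y₀, κ)) (by positivity) (min_le_left _ _))
      (biLoc_mono (hD₂ _ hΛ (y₀, κ)) hA₂ (min_le_right _ _)) _ _
  have hC0 : ∀ y₀ : Site (3 + 1), 0 ≤ |∑' e : Site (3 + 1), S ν (translate Mc y' e) κ y₀| * (A₁ * Real.exp (-(ρ₁ / 2) * l1 (((L : ℕ) : ℤ) • y - ((L : ℕ) : ℤ) • y₀)))
      + |S μ y κ y₀| * A₂ := fun y₀ => by positivity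
  have hCs : Summable (fun y₀ : Site (3 + 1) => |∑' e : Site (3 + 1), S ν (translate Mc y' e) κ y₀| * (A₁ * Real.exp (-(ρ₁ / 2) * l1 (((L : ℕ) : ℤ) • y - ((L : ℕ) : ℤ) • y₀)))
      + |S μ y κ y₀| * A₂) := by
    refine Summable.add ?_ ?_
    · refine ((summable_exp_shift (half_pos hρ₁) y).mul_left (CS * latticeConst (3 + 1) δS * A₁)).of_nonneg_of_le (fun y₀ => by positivity) (fun y₀ => ?_)
      calc |∑' e : Site (3 + 1), S ν (translate Mc y' e) κ y₀| * (A₁ * Real.exp (-(ρ₁ / 2) * l1 (((L : ℕ) : ℤ) • y - ((L : ℕ) : ℤ) • y₀)))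
          ≤ (CS * latticeConst (3 + 1) δS) * (A₁ * Real.exp (-(ρ₁ / 2) * l1 (y - y₀))) :=
            mul_le_mul (hSw y₀) (mul_le_mul_of_nonneg_left (exp_block_le L hL (by positivity) y y₀) hA₁) (by positivity)
              (mul_nonneg hCS (latticeConst_nonneg _ hδS.le))
        _ = CS * latticeConst (3 + 1) δS * A₁ * Real.exp (-(ρ₁ / 2) * l1 (y - y₀)) := by ring
    · refine ((summable_exp_shift' hδS y).mul_left (CS * A₂)).of_nonneg_of_le (fun y₀ => by positivity) (fun y₀ => ?_)
      calc |S μ y κ y₀| * A₂ ≤ (CS * Real.exp (-δS * l1 (y₀ - y))) * A₂ := mul_le_mul_of_nonneg_right (hS μ y κ y₀) hA₂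
        _ = CS * A₂ * Real.exp (-δS * l1 (y₀ - y)) := by ring
  have hjoint := summable_perZ_dper_family_of_biLoc T hfam hC0 hδ0 hCs x w a b
  -- the identity: PART 70 §4, then additivity and the scalars window by window
  have h1 : ∀ y₀ : Site (3 + 1), Summable (fun c : Site (3 + 1) × Site (3 + 1) =>
      (∑' e : Site (3 + 1), S ν (translate Mc y' e) κ y₀) * defKerZ L tabs κ₂ (lam μ y) (y₀, κ) (translate T x c.2) (translate T (translate T w c.1) c.2) a b) :=
    fun y₀ => (summable_perZ_dper_of_biLoc T (hD₁ μ y (y₀, κ)) (by positivity) x w a b).mul_left _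
  have h2 : ∀ y₀ : Site (3 + 1), Summable (fun c : Site (3 + 1) × Site (3 + 1) =>
      S μ y κ y₀ * defKerZ L tabs κ₂ (fun u => ∑' e : Site (3 + 1), lam ν (translate Mc y' e) u) (y₀, κ) (translate T x c.2) (translate T (translate T w c.1) c.2) a b) :=
    fun y₀ => (summable_perZ_dper_of_biLoc T (hD₂ _ hΛ (y₀, κ)) hρ₂ x w a b).mul_left _
  have hterm : ∀ y₀ : Site (3 + 1), perZ T (dper T (fun x' w' a' b' =>
      (∑' e : Site (3 + 1), S ν (translate Mc y' e) κ y₀) * defKerZ L tabs κ₂ (lam μ y) (y₀, κ) x' w' a' b'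
        + S μ y κ y₀ * defKerZ L tabs κ₂ (fun u => ∑' e : Site (3 + 1), lam ν (translate Mc y' e) u) (y₀, κ) x' w' a' b')) x w a b
      = (∑' e : Site (3 + 1), S ν (translate Mc y' e) κ y₀) * perZ T (dper T (defKerZ L tabs κ₂ (lam μ y) (y₀, κ))) x w a b
          + S μ y κ y₀ * perZ T (dper T (defKerZ L tabs κ₂ (fun u => ∑' e : Site (3 + 1), lam ν (translate Mc y' e) u) (y₀, κ))) x w a b := by
    intro y₀
    rw [perZ_dper_add T (V := fun x' w' a' b' => (∑' e : Site (3 + 1), S ν (translate Mc y' e) κ y₀) * defKerZ L tabs κ₂ (lam μ y) (y₀, κ) x' w' a' b')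
      (W := fun x' w' a' b' => S μ y κ y₀ * defKerZ L tabs κ₂ (fun u => ∑' e : Site (3 + 1), lam ν (translate Mc y' e) u) (y₀, κ) x' w' a' b')
      x w a b (h1 y₀) (h2 y₀),
      perZ_dper_const_mul T _ (defKerZ L tabs κ₂ (lam μ y) (y₀, κ)) x w a b,
      perZ_dper_const_mul T _ (defKerZ L tabs κ₂ (fun u => ∑' e : Site (3 + 1), lam ν (translate Mc y' e) u) (y₀, κ)) x w a b]
  -- summabilities of the two resulting families: entries bounded by the constants times `K_{4}(·)²`
  have hP₁ : ∀ y₀ : Site (3 + 1), |perZ T (dper T (defKerZ L tabs κ₂ (lam μ y) (y₀, κ))) x w a b|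
      ≤ A₁ * Real.exp (-(ρ₁ / 2) * l1 (y - y₀)) * (latticeConst (3 + 1) (ρ₁ / 4) * latticeConst (3 + 1) (ρ₁ / 4)) := by
    intro y₀
    refine (abs_perZ_dper_le_of_biLoc T (hD₁ μ y (y₀, κ)) (by positivity) (by positivity) x w a b).trans ?_
    exact mul_le_mul_of_nonneg_right (mul_le_mul_of_nonneg_left (exp_block_le L hL (by positivity) y y₀) hA₁)
      (mul_nonneg (latticeConst_nonneg _ (by positivity)) (latticeConst_nonneg _ (by positivity)))
  have hP₂ : ∀ y₀ : Site (3 + 1), |perZ T (dper T (defKerZ L tabs κ₂ (fun u => ∑' e : Site (3 + 1), lam ν (translate Mc y' e) u) (y₀, κ))) x w a b|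
      ≤ A₂ * (latticeConst (3 + 1) ρ₂ * latticeConst (3 + 1) ρ₂) :=
    fun y₀ => abs_perZ_dper_le_of_biLoc T (hD₂ _ hΛ (y₀, κ)) hA₂ hρ₂ x w a b
  have hs1 : Summable (fun y₀ : Site (3 + 1) =>
      (∑' e : Site (3 + 1), S ν (translate Mc y' e) κ y₀) * perZ T (dper T (defKerZ L tabs κ₂ (lam μ y) (y₀, κ))) x w a b) := by
    refine ((summable_exp_shift (half_pos hρ₁) y).mul_left
      (CS * latticeConst (3 + 1) δS * (A₁ * (latticeConst (3 + 1) (ρ₁ / 4) * latticeConst (3 + 1) (ρ₁ / 4))))).of_norm_bounded fun y₀ => ?_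
    rw [Real.norm_eq_abs, abs_mul]
    calc |∑' e : Site (3 + 1), S ν (translate Mc y' e) κ y₀| * |perZ T (dper T (defKerZ L tabs κ₂ (lam μ y) (y₀, κ))) x w a b|
        ≤ (CS * latticeConst (3 + 1) δS) * (A₁ * Real.exp (-(ρ₁ / 2) * l1 (y - y₀)) * (latticeConst (3 + 1) (ρ₁ / 4) * latticeConst (3 + 1) (ρ₁ / 4))) :=
          mul_le_mul (hSw y₀) (hP₁ y₀) (abs_nonneg _) (mul_nonneg hCS (latticeConst_nonneg _ hδS.le))
      _ = CS * latticeConst (3 + 1) δS * (A₁ * (latticeConst (3 + 1) (ρ₁ / 4) * latticeConst (3 + 1) (ρ₁ / 4))) * Real.exp (-(ρ₁ / 2) * l1 (y - y₀)) := by ring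
  have hs2 : Summable (fun y₀ : Site (3 + 1) =>
      S μ y κ y₀ * perZ T (dper T (defKerZ L tabs κ₂ (fun u => ∑' e : Site (3 + 1), lam ν (translate Mc y' e) u) (y₀, κ))) x w a b) := by
    refine ((summable_exp_shift' hδS y).mul_left (CS * (A₂ * (latticeConst (3 + 1) ρ₂ * latticeConst (3 + 1) ρ₂)))).of_norm_bounded fun y₀ => ?_
    rw [Real.norm_eq_abs, abs_mul]
    calc |S μ y κ y₀| * |perZ T (dper T (defKerZ L tabs κ₂ (fun u => ∑' e : Site (3 + 1), lam ν (translate Mc y' e) u) (y₀, κ))) x w a b|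
        ≤ (CS * Real.exp (-δS * l1 (y₀ - y))) * (A₂ * (latticeConst (3 + 1) ρ₂ * latticeConst (3 + 1) ρ₂)) :=
          mul_le_mul (hS μ y κ y₀) (hP₂ y₀) (abs_nonneg _) (by positivity)
      _ = CS * (A₂ * (latticeConst (3 + 1) ρ₂ * latticeConst (3 + 1) ρ₂)) * Real.exp (-δS * l1 (y₀ - y)) := by ring
  refine ⟨?_, hjoint.prod_symm.prod, hs1, hs2⟩
  rw [perZ_dper_tsum T _ x w a b hjoint]
  exact tsum_congr hterm

end Window

end Summit.QuantumFields.BalabanUV.Beta.FP.TowerDoorPeriodisedWindow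

end
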